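import Summits.AnomalousDissipation.AnomalousDissipation.Theorems.SawtoothPulseCascadeK1LocalisedCascadeKHSheetBandTableB

/-!
# K2 lane (route-2 `SawtoothPulseCascade`, crux dir `K1LocalisedCascade`): S2 in OPERATOR form — `‖e^{tX}‖_M ≤ 16` on `[0, 8]`, and the rate form

Helper file of the K2 lane (ACL item stmt-AnomalousDissipation-19491). Consequences of `sheet_energy_le_sixteen` (p683995) in the shapes the
forced (Duhamel) step of S2-cert consumes (`sheetAmps = ∫ P(θ−s) f(s) ds` in p4's typed slot map):
* `threeCase_hasDerivAt_C` / `threeCase_hasDerivAt_Sn`: the three-case scalar pair `(C, Sn)` of p4's `propC`/`propSn`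
  (`(cosh √λ t, sinh √λ t/√λ) | (cos √(−λ) t, sin √(−λ) t/√(−λ)) | (1, t)`) satisfies `C′ = λ Sn`, `Sn′ = C` (any real `λ`);
* `sheet_propagator_le_sixteen`: for ANY scalar pair with `C′ = −k²c²·Sn`, `Sn′ = C`, `C(0) = 1`, `Sn(0) = 0` and every `v`:
  `khForm(C(t)v + Sn(t)Xv) ≤ 16²·khForm(v)` for `t ∈ [0, 8]` — the explicit propagator `P(t) = C(t)·1 + Sn(t)·X` has `M`-operator norm `≤ 16`;
  `sheet_threeCase_le_sixteen`: the same for p4's three-case pair with `λ = −k²c²(k,β)`;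
* `khForm_nonneg`, `sheet_energy_lyapunov_sixteen`: `khForm ≥ 0`, hence the rate form `khForm(q θ) ≤ 16²·e^{2σθ}·khForm(q 0)`
  (`KHSheetLyapunov 8 16` of the K2 sketch, unfolded; the sharp non-normality constant is `7.05`).
No definitions; no statement about the crux. [cite: Drazin2002, §8.3 (8.36)–(8.38)] [problem: turb]
-/

-- `Summit.<Summit>.<Problem>`: single-conjunct summit, the duplicate namespace segment is deliberate.
set_option linter.dupNamespace false

noncomputable section

namespace Summit.AnomalousDissipation.AnomalousDissipation.Theorems.SawtoothPulseCascade.K2PhaseBudget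

open Set Real Complex Literature.Analysis.FluidPDE.SawtoothCascade

/-! ## §1 The three-case scalar pair -/

/-- `C′ = λ·Sn` for the three-case pair (any real `λ`). [folklore] -/
theorem threeCase_hasDerivAt_C (lam t : ℝ) :
    HasDerivAt (fun u : ℝ => (if 0 < lam then Real.cosh (Real.sqrt lam * u)
        else if lam < 0 then Real.cos (Real.sqrt (-lam) * u) else 1 : ℝ))
      (lam * (if 0 < lam then Real.sinh (Real.sqrt lam * t) / Real.sqrt lam
        else if lam < 0 then Real.sin (Real.sqrt (-lam) * t) / Real.sqrt (-lam) else t : ℝ)) t := by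
  rcases lt_trichotomy lam 0 with h | h | h
  · have h' : ¬ (0 < lam) := by linarith
    simp only [h, h', if_false, if_true]
    set ω := Real.sqrt (-lam) with hω
    have hω0 : 0 < ω := Real.sqrt_pos.2 (by linarith)
    have hω2 : ω ^ 2 = -lam := by rw [hω, Real.sq_sqrt]; linarith
    have hlw : lam / ω = -ω := by rw [div_eq_iff hω0.ne']; linear_combination hω2
    have := (Real.hasDerivAt_cos (ω * t)).comp t ((hasDerivAt_id t).const_mul ω)
    refine this.congr_deriv ?_
    calc -Real.sin (ω * t) * (ω * 1) = lam / ω * Real.sin (ω * t) := by rw [hlw]; ring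
      _ = lam * (Real.sin (ω * t) / ω) := by ring
  · subst h
    simp only [lt_irrefl, if_false, zero_mul]
    exact hasDerivAt_const t (1 : ℝ)
  · have h' : ¬ (lam < 0) := by linarith
    simp only [h, h', if_false, if_true]
    set r := Real.sqrt lam with hr
    have hr0 : 0 < r := Real.sqrt_pos.2 h
    have hr2 : r ^ 2 = lam := by rw [hr, Real.sq_sqrt h.le]
    have hlr : lam / r = r := by rw [div_eq_iff hr0.ne']; linear_combination -hr2
    have := (Real.hasDerivAt_cosh (r * t)).comp t ((hasDerivAt_id t).const_mul r)
    refine this.congr_deriv ?_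
    calc Real.sinh (r * t) * (r * 1) = lam / r * Real.sinh (r * t) := by rw [hlr]; ring
      _ = lam * (Real.sinh (r * t) / r) := by ring

/-- `Sn′ = C` for the three-case pair (any real `λ`). [folklore] -/
theorem threeCase_hasDerivAt_Sn (lam t : ℝ) :
    HasDerivAt (fun u : ℝ => (if 0 < lam then Real.sinh (Real.sqrt lam * u) / Real.sqrt lam
        else if lam < 0 then Real.sin (Real.sqrt (-lam) * u) / Real.sqrt (-lam) else u : ℝ))
      (if 0 < lam then Real.cosh (Real.sqrt lam * t)
        else if lam < 0 then Real.cos (Real.sqrt (-lam) * t) else 1 : ℝ) t := by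
  rcases lt_trichotomy lam 0 with h | h | h
  · have h' : ¬ (0 < lam) := by linarith
    simp only [h, h', if_false, if_true]
    set ω := Real.sqrt (-lam) with hω
    have hω0 : 0 < ω := Real.sqrt_pos.2 (by linarith)
    have := ((Real.hasDerivAt_sin (ω * t)).comp t ((hasDerivAt_id t).const_mul ω)).div_const ω
    refine this.congr_deriv ?_
    field_simp
  · subst h
    simp only [lt_irrefl, if_false]
    exact hasDerivAt_id t
  · have h' : ¬ (lam < 0) := by linarith
    simp only [h, h', if_false, if_true]
    set r := Real.sqrt lam with hr
    have hr0 : 0 < r := Real.sqrt_pos.2 h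
    have := ((Real.hasDerivAt_sinh (r * t)).comp t ((hasDerivAt_id t).const_mul r)).div_const r
    refine this.congr_deriv ?_
    field_simp

/-! ## §2 Operator form of the `B = 16` bound -/

/-- **`‖P(t)‖_M ≤ 16` on `[0, 8]`.** For any scalar pair `(C, Sn)` with `C′ = −k²c²(k,β)·Sn`, `Sn′ = C`, `C(0) = 1`, `Sn(0) = 0` (so that
`t ↦ C(t)v + Sn(t)Xv` is THE solution of the sheet block from `v`) and every `v`: `khForm(C(t)v + Sn(t)Xv) ≤ 16²·khForm(v)`, `t ∈ [0, 8]`.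
[cite: Drazin2002, §8.3 (8.36)–(8.38)] -/
theorem sheet_propagator_le_sixteen {k β : ℝ} (hk : 0 < k)
    {p S : ℂ} {m : ℝ} {F : (Fin 2 → ℂ) → (Fin 2 → ℂ)}
    (hp : p = ((π / 2 + 2 * sawSigma0 k β : ℝ) : ℂ)) (hS : S = sawS k β) (hm : m = -sawSigma0 k β)
    (hF : F = fun v => ![I * k * (-p * v 0 - 2 * S * v 1), I * k * (2 * (starRingEnd ℂ) S * v 0 + p * v 1)])
    {C Sn : ℝ → ℝ} (hC : ∀ θ, HasDerivAt C (-(k ^ 2 * sawC2 k β) * Sn θ) θ) (hSn : ∀ θ, HasDerivAt Sn (C θ) θ)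
    (hC0 : C 0 = 1) (hSn0 : Sn 0 = 0) (v : Fin 2 → ℂ) :
    ∀ t ∈ Icc (0 : ℝ) 8,
      m * (Complex.normSq ((((C t : ℝ) : ℂ) • v + ((Sn t : ℝ) : ℂ) • F v) 0) +
            Complex.normSq ((((C t : ℝ) : ℂ) • v + ((Sn t : ℝ) : ℂ) • F v) 1)) -
          2 * ((starRingEnd ℂ) ((((C t : ℝ) : ℂ) • v + ((Sn t : ℝ) : ℂ) • F v) 0) * S *
            (((C t : ℝ) : ℂ) • v + ((Sn t : ℝ) : ℂ) • F v) 1).re ≤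
        16 ^ 2 * (m * (Complex.normSq (v 0) + Complex.normSq (v 1)) - 2 * ((starRingEnd ℂ) (v 0) * S * v 1).re) := by
  intro t ht
  have hq : ∀ θ ∈ Icc (0 : ℝ) 8, HasDerivWithinAt (fun t : ℝ => ((C t : ℝ) : ℂ) • v + ((Sn t : ℝ) : ℂ) • F v)
      (F ((fun t : ℝ => ((C t : ℝ) : ℂ) • v + ((Sn t : ℝ) : ℂ) • F v) θ)) (Icc (0 : ℝ) 8) θ :=
    fun θ _ => (sheetPropagator_hasDerivAt hp hS hF hC hSn v θ).hasDerivWithinAt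
  have h := sheet_energy_le_sixteen hk hp hS hm hF hq t ht
  simpa only [hC0, hSn0, Complex.ofReal_one, Complex.ofReal_zero, one_smul, zero_smul, add_zero] using h

/-- The same for p4's three-case pair `(propC, propSn)` with `λ = −k²c²(k,β)` (`khLam`): the typed propagator of the slot map has
`M`-operator norm `≤ 16` on `[0, 8]`, for every line `k > 0` and Bloch phase. [cite: Drazin2002, §8.3 (8.36)–(8.38)] -/
theorem sheet_threeCase_le_sixteen {k β : ℝ} (hk : 0 < k)
    {p S : ℂ} {m : ℝ} {F : (Fin 2 → ℂ) → (Fin 2 → ℂ)}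
    (hp : p = ((π / 2 + 2 * sawSigma0 k β : ℝ) : ℂ)) (hS : S = sawS k β) (hm : m = -sawSigma0 k β)
    (hF : F = fun v => ![I * k * (-p * v 0 - 2 * S * v 1), I * k * (2 * (starRingEnd ℂ) S * v 0 + p * v 1)])
    {lam : ℝ} (hlam : lam = -(k ^ 2 * sawC2 k β)) (v : Fin 2 → ℂ) :
    ∀ t ∈ Icc (0 : ℝ) 8,
      let C : ℝ := if 0 < lam then Real.cosh (Real.sqrt lam * t) else if lam < 0 then Real.cos (Real.sqrt (-lam) * t) else 1
      let Sn : ℝ := if 0 < lam then Real.sinh (Real.sqrt lam * t) / Real.sqrt lam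
        else if lam < 0 then Real.sin (Real.sqrt (-lam) * t) / Real.sqrt (-lam) else t
      m * (Complex.normSq ((((C : ℝ) : ℂ) • v + ((Sn : ℝ) : ℂ) • F v) 0) + Complex.normSq ((((C : ℝ) : ℂ) • v + ((Sn : ℝ) : ℂ) • F v) 1)) -
          2 * ((starRingEnd ℂ) ((((C : ℝ) : ℂ) • v + ((Sn : ℝ) : ℂ) • F v) 0) * S * (((C : ℝ) : ℂ) • v + ((Sn : ℝ) : ℂ) • F v) 1).re ≤
        16 ^ 2 * (m * (Complex.normSq (v 0) + Complex.normSq (v 1)) - 2 * ((starRingEnd ℂ) (v 0) * S * v 1).re) := by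
  intro t ht
  have hC : ∀ θ, HasDerivAt (fun u : ℝ => (if 0 < lam then Real.cosh (Real.sqrt lam * u)
      else if lam < 0 then Real.cos (Real.sqrt (-lam) * u) else 1 : ℝ)) (-(k ^ 2 * sawC2 k β) *
        (fun u : ℝ => (if 0 < lam then Real.sinh (Real.sqrt lam * u) / Real.sqrt lam
          else if lam < 0 then Real.sin (Real.sqrt (-lam) * u) / Real.sqrt (-lam) else u : ℝ)) θ) θ := by
    intro θ; rw [← hlam]; exact threeCase_hasDerivAt_C lam θ
  have hSn := fun θ => threeCase_hasDerivAt_Sn lam θ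
  have h := sheet_propagator_le_sixteen hk hp hS hm hF hC hSn (by simp) (by simp) v t ht
  exact h

/-! ## §3 Nonnegativity of the form and the rate form -/

/-- `khForm ≥ 0`: the energy Gram `M = −[[Σ₀, S],[S̄, Σ₀]]` is positive definite (`khGram_ge`). [folklore] -/
theorem khForm_nonneg {k : ℝ} (hk : 0 < k) (β : ℝ) (q₀ q₁ : ℂ) :
    0 ≤ -sawSigma0 k β * (Complex.normSq q₀ + Complex.normSq q₁) - 2 * ((starRingEnd ℂ) q₀ * sawS k β * q₁).re := by
  have h := khGram_ge hk β q₀ q₁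
  have h0 : 0 ≤ (-sawSigma0 k β - Real.sqrt (Complex.normSq (sawS k β))) * (Complex.normSq q₀ + Complex.normSq q₁) :=
    mul_nonneg h.1.le (add_nonneg (Complex.normSq_nonneg _) (Complex.normSq_nonneg _))
  exact h0.trans h.2

/-- **Rate form** (`KHSheetLyapunov 8 16` of the K2 sketch, unfolded): `khForm(q θ) ≤ 16²·e^{2σ(k,β)θ}·khForm(q 0)` on `[0, 8]` for every
solution of the sheet block (`σ = sawSigma k β ≥ 0`; from the absolute bound and `khForm ≥ 0`). [cite: Drazin2002, §8.3 (8.36)–(8.38)] -/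
theorem sheet_energy_lyapunov_sixteen {k β : ℝ} (hk : 0 < k)
    {q : ℝ → (Fin 2 → ℂ)}
    (hq : ∀ θ ∈ Icc (0 : ℝ) 8, HasDerivWithinAt q
      ((fun v : Fin 2 → ℂ => ![I * k * (-(((π / 2 + 2 * sawSigma0 k β : ℝ) : ℂ)) * v 0 - 2 * sawS k β * v 1),
        I * k * (2 * (starRingEnd ℂ) (sawS k β) * v 0 + ((π / 2 + 2 * sawSigma0 k β : ℝ) : ℂ) * v 1)]) (q θ)) (Icc (0 : ℝ) 8) θ) :
    ∀ θ ∈ Icc (0 : ℝ) 8,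
      -sawSigma0 k β * (Complex.normSq (q θ 0) + Complex.normSq (q θ 1)) - 2 * ((starRingEnd ℂ) (q θ 0) * sawS k β * q θ 1).re ≤
        16 ^ 2 * Real.exp (2 * sawSigma k β * θ) *
          (-sawSigma0 k β * (Complex.normSq (q 0 0) + Complex.normSq (q 0 1)) - 2 * ((starRingEnd ℂ) (q 0 0) * sawS k β * q 0 1).re) := by
  intro θ hθ
  have h := sheet_energy_le_sixteen hk rfl rfl rfl rfl hq θ hθ
  have h0 := khForm_nonneg hk β (q 0 0) (q 0 1)
  have hσ : 0 ≤ sawSigma k β := mul_nonneg hk.le (Real.sqrt_nonneg _)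
  have he : 1 ≤ Real.exp (2 * sawSigma k β * θ) := Real.one_le_exp (by have := hθ.1; positivity)
  calc _ ≤ 16 ^ 2 * (-sawSigma0 k β * (Complex.normSq (q 0 0) + Complex.normSq (q 0 1)) -
          2 * ((starRingEnd ℂ) (q 0 0) * sawS k β * q 0 1).re) := h
    _ = 16 ^ 2 * 1 * (-sawSigma0 k β * (Complex.normSq (q 0 0) + Complex.normSq (q 0 1)) -
          2 * ((starRingEnd ℂ) (q 0 0) * sawS k β * q 0 1).re) := by ring
    _ ≤ _ := by
        apply mul_le_mul_of_nonneg_right _ h0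
        exact mul_le_mul_of_nonneg_left he (by norm_num)

end Summit.AnomalousDissipation.AnomalousDissipation.Theorems.SawtoothPulseCascade.K2PhaseBudget

end
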